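import Mathlib
import Summits.Ventures.PercRepro2.CoinTreeCore
import Summits.Ventures.PercRepro2.CoinOrTailKDefs
import Summits.Ventures.PercRepro2.CoinKSureCore
import Summits.Ventures.PercRepro2.CoinKSureCoinsAlg
import Summits.Ventures.PercRepro2.CoinKSureCoins

/-!
# THREE uncovered entries, a HEAD-AWARE core, ARBITRARY tail coins: an instantiation
(blind cell PercRepro2, night-2 g14; NIGHT2-DARC.md §49)

A concrete coin system on `Fin 12` (s = 0, m₁ = 1, m₂ = 2, r₁ = 3, r₂ = 4, r₃ = 5, a = 6, w = 7,
t = 8; the vertices 9, 10, 11 are unused — they serve as the virtual labels of the coin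
splitting): the five branches `s → m₁`, `s → m₂`, `s → r₁`, `s → r₂`, `s → r₃` of an out-tree
core, the three tail arcs `r₁ → a`, `r₂ → a`, `r₃ → a` (coins 5, 6, 7, of ANY probability), the
head coins `a → t`, `w → t`, `r₁ → t`, `r₂ → w`, `r₃ → w`, and the MARKER arcs `m₁ → w`, `m₂ → w`
(the head sees both markers, through the same head vertex `w` as two of the entries: the
markers are correlated with each other and with the entries under the `R`-law, and `Φ(E)` is
strictly positive — e.g. `2458942810782030633165031575 / 23100558164392448682567057539072` for
the probability vector of seed 7 of mining/night-2/g14/example_check.py).  None of the three entries is covered by a marker and the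
traces are pairwise incomparable — the case no earlier theorem of the row reaches (k = 3).
`OrTailK` and `TreeCore` hold by `decide`; `darc_of_orTailTreeKSure` gives row 2′DARC at `a → w`
for the markers `m₁, m₂` with the three tail coins sure (`darc_kSure_example`), and
`darc_of_orTailTreeK_coins` for EVERY probability vector (`darc_kCoins_example`) — no
hypothesis at all.
-/

namespace Summit.Ventures.PercRepro2.Coin

namespace KSureExample

open Classical

/-- The fifteen coins of the example. -/
def arcsEx : Fin 15 → Finset (Fin 12 × Fin 12)
  | 0 => {(0, 1)}   -- s → m₁
  | 1 => {(0, 2)}   -- s → m₂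
  | 2 => {(0, 3)}   -- s → r₁
  | 3 => {(0, 4)}   -- s → r₂
  | 4 => {(0, 5)}   -- s → r₃
  | 5 => {(3, 6)}   -- r₁ → a  (sure)
  | 6 => {(4, 6)}   -- r₂ → a  (sure)
  | 7 => {(5, 6)}   -- r₃ → a  (sure)
  | 8 => {(6, 8)}   -- a → t
  | 9 => {(7, 8)}   -- w → t
  | 10 => {(3, 8)}  -- r₁ → t
  | 11 => {(4, 7)}  -- r₂ → w
  | 12 => {(5, 7)}  -- r₃ → w
  | 13 => {(1, 7)}  -- m₁ → w  (the head sees the marker m₁)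
  | 14 => {(2, 7)}  -- m₂ → w  (the head sees the marker m₂)

/-- The entry coins: `c r₁ = 5`, `c r₂ = 6`, `c r₃ = 7`. -/
def cEx : Fin 12 → Fin 15
  | 3 => 5
  | 4 => 6
  | 5 => 7
  | _ => 0

/-- The tree coins. -/
def tcEx : Fin 12 → Fin 15
  | 1 => 0
  | 2 => 1
  | 3 => 2
  | 4 => 3
  | 5 => 4
  | _ => 0

/-- The parent map (every core vertex is a child of `s`). -/
def parEx : Fin 12 → Fin 12 := fun _ => 0

/-- The rank. -/
def rkEx : Fin 12 → ℕ
  | 1 => 1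
  | 2 => 1
  | 3 => 1
  | 4 => 1
  | 5 => 1
  | _ => 0

/-- The virtual labels of the coin splitting: `r₁ ↦ 9`, `r₂ ↦ 10`, `r₃ ↦ 11`. -/
def vtEx : Fin 12 → Fin 12
  | 3 => 9
  | 4 => 10
  | 5 => 11
  | _ => 0

/-- Every coin is a single arc, so `SameEnds` holds. -/
lemma sameEnds_ex : SameEnds arcsEx := by
  intro e xy hxy x'y' hx'y'
  fin_cases e <;> simp [arcsEx] at hxy hx'y' <;> subst hxy <;> subst hx'y' <;>
    exact ⟨Or.inl rfl, Or.inr rfl⟩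

set_option maxRecDepth 20000 in
/-- `{m₁, m₂, r₁, r₂, r₃}` is an out-tree core of `s`. -/
lemma treeCore_ex : TreeCore arcsEx 0 {1, 2, 3, 4, 5} tcEx parEx rkEx where
  tree := by decide
  par_mem := by decide
  rank := by decide
  into_C := by decide
  into_s := by decide
  s_notin := by decide

set_option maxRecDepth 20000 in
/-- The core with the tail `a = 6` entered from `r₁, r₂, r₃` is a three-entry OR-tail. -/
lemma orTailK_ex : OrTailK arcsEx 0 {1, 2, 3, 4, 5} {3, 4, 5} cEx 6 where
  ent_sub := by decide
  s_notin := by decide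
  a_notin := by decide
  a_ne_s := by decide
  into_U := by decide
  into_s := by decide
  into_a := by decide
  arcs_c := by decide
  c_inj := by decide

/-- **Row 2′DARC at the arc `a → w` for the markers `m₁, m₂`, with THREE uncovered entries of
pairwise incomparable traces, the markers' own arcs into the head, and every probability vector
whose three tail coins are sure.** -/
theorem darc_kSure_example {R : Type*} [Field R] [LinearOrder R] [IsStrictOrderedRing R]
    (pr : Fin 15 → R) (hp : IsProbVec pr) (h5 : pr 5 = 1) (h6 : pr 6 = 1) (h7 : pr 7 = 1) :
    DARC pr arcsEx 0 {8} 1 2 6 7 := by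
  have hsure : ∀ r ∈ ({3, 4, 5} : Finset (Fin 12)), pr (cEx r) = 1 := by
    intro r hr
    simp only [Finset.mem_insert, Finset.mem_singleton] at hr
    rcases hr with rfl | rfl | rfl
    · exact h5
    · exact h6
    · exact h7
  exact darc_of_orTailTreeKSure pr hp sameEnds_ex orTailK_ex treeCore_ex (by decide) (by decide)
    hsure (by decide) (by decide) (by decide) (by decide)

/-- **Row 2′DARC at the arc `a → w` for the markers `m₁, m₂`, with THREE uncovered entries of
pairwise incomparable traces, the markers' own arcs into the head, and EVERY probability
vector — no hypothesis at all.** -/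
theorem darc_kCoins_example {R : Type*} [Field R] [LinearOrder R] [IsStrictOrderedRing R]
    (pr : Fin 15 → R) (hp : IsProbVec pr) :
    DARC pr arcsEx 0 {8} 1 2 6 7 :=
  darc_of_orTailTreeK_coins pr hp sameEnds_ex orTailK_ex treeCore_ex (by decide) (by decide)
    vtEx (by decide) (by decide) (by decide) (by decide) (by decide) (by decide)

end KSureExample

end Summit.Ventures.PercRepro2.Coin
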